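import Mathlib
import HarnessLib
import Literature.Probability.MarkovChains.TotalVariation
import Literature.Probability.ImportanceSampling.OptimalImportanceDistribution
import Summits.Ventures.LatticeQCDFlow.Scaling.VarianceLaws
import Summits.Ventures.LatticeQCDFlow.Exactness.JarzynskiFinite

/-!
# TiltedMarginals — the Feynman–Kac (tilted) marginals of a switching protocol, the `L²(1/π)`
# deviation `massDev` of an un-normalised measure from its own-mass multiple of `π`, and the scalar
# 2×2 majorant lemma (the model- and layer-free part of the ESS floor / work-MGF
# machinery of `Scaling/TiltedProtocolRecursion`)

HONEST FRAMING: exact (Metropolis-corrected) sampling algorithms for lattice gauge theory;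
figures of merit are autocorrelation/cost numbers at stated couplings and volumes; no
continuum-physics claim.

Venture `LatticeQCDFlow` (cell pub-lqcd), topic `Scaling`; FANOUT row 19 (`su2-snf`, GEN-6).
OUR WORK (elementary finite sums), nothing here is cited as a fact.  Vocabulary: the Literature's
row kernels `K : X → X → ℝ`, `stepLaw K μ = μK`, Pearson `chiSqDiv μ π = Σ (μ − π)²/π`; the
protocol objects `pathLaw`, `transProb`, `work` of `Exactness/JarzynskiFinite`.
The second moment of the Jarzynski weights `E_F[e^{−2W}]` (more generally `E_F[e^{−tW}]`) is the
total mass of the TILTED marginal `ν_n`, `ν_0 = μ₀`, `ν_{k+1} = (g_k · ν_k) P_k`,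
`g_k = e^{−t(S_{k+1} − S_k)}` (a discrete Feynman–Kac semigroup).  This file:

* `tiltEvolve g P μ k` — the tilted marginal (`tiltEvolve_succ_shift`, `tiltEvolve_pos`,
  `sum_tiltEvolve_succ`: the mass recursion `|ν_{k+1}| = ν_k[g_k]` for unit row sums);
* **`sum_pathLaw_prod_mul_apply`** — FEYNMAN–KAC MARGINALISATION:
  `Σ_ω pathLaw μ P ω · Π_{k<n} g_k(ω_k) · f(ω_n) = Σ_x (tiltEvolve g P μ n)(x) f(x)`;
  `exp_neg_work_sq_eq_prod` — `(e^{−W})² = Π_{k<n} e^{−2(S_{k+1}(ω_k) − S_k(ω_k))}`;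
* `massDev π ν = ‖ν − |ν|·π‖_{L²(1/π)}` (`= |ν|·√χ²(ν/|ν| ‖ π)`; `0` on multiples of `π`;
  `1`-homogeneous: `massDev_smul`, `massDev_of_sum_eq_one`, `massDev_mul_self`);
* `coupled_majorant_bound` / `coupled_majorant_exp_bound` — if `u_0 ≤ 1`, `v_0 ≤ 0`,
  `u_{k+1} ≤ u_k + s·v_k`, `v_{k+1} ≤ a·u_k + θ·v_k` (`s, a ≥ 0`, `0 ≤ θ < 1`), then
  `u_k ≤ (1 + s·a/(1−θ))^k ≤ exp(k·s·a/(1−θ))`.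

The tilted lag bound and the two layer-dependent inequalities (contraction of `massDev` by a
`χ²`-contracting layer; tilt and change of reference) are `Scaling/TiltedProtocolRecursion`.
-/

namespace Summit.Ventures.LatticeQCDFlow.Scaling

open Finset
open Literature.Probability.MarkovChains (IsRowStochastic stepLaw)
open Literature.Probability.ImportanceSampling (chiSqDiv chiSqDiv_def chiSqDiv_eq_sum_sq_div)
open Summit.Ventures.LatticeQCDFlow.Exactness
open Summit.Ventures.LatticeQCDFlow.Theory2

variable {X : Type*} [Fintype X]

/-! ## The tilted (Feynman–Kac) marginals -/

/-- The TILTED marginal of a protocol: `ν_0 = μ`, `ν_{k+1} = (g_k · ν_k) P_k` (tilt by the weight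
`g_k`, then apply the layer `P_k`); with `g_k = e^{−2(S_{k+1} − S_k)}` its mass is `E_F[e^{−2W}]`. -/
def tiltEvolve (g : ℕ → X → ℝ) (P : ℕ → X → X → ℝ) (μ : X → ℝ) : ℕ → X → ℝ
  | 0 => μ
  | k + 1 => stepLaw (P k) (fun x => g k x * tiltEvolve g P μ k x)

/-- Unfolding at time `0`. -/
@[simp] theorem tiltEvolve_zero (g : ℕ → X → ℝ) (P : ℕ → X → X → ℝ) (μ : X → ℝ) :
    tiltEvolve g P μ 0 = μ := rfl

/-- Unfolding at a successor time: tilt by `g_k`, then apply `P_k`. -/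
theorem tiltEvolve_succ (g : ℕ → X → ℝ) (P : ℕ → X → X → ℝ) (μ : X → ℝ) (k : ℕ) :
    tiltEvolve g P μ (k + 1) = stepLaw (P k) (fun x => g k x * tiltEvolve g P μ k x) := rfl

/-- Re-indexing: after the first tilt-and-relax step the recursion restarts from `(g_0 μ)P_0` with
the shifted data. -/
theorem tiltEvolve_succ_shift (g : ℕ → X → ℝ) (P : ℕ → X → X → ℝ) (μ : X → ℝ) :
    ∀ k, tiltEvolve g P μ (k + 1) =
      tiltEvolve (fun k => g (k + 1)) (fun k => P (k + 1))
        (stepLaw (P 0) (fun x => g 0 x * μ x)) k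
  | 0 => rfl
  | k + 1 => by
    rw [tiltEvolve_succ, tiltEvolve_succ_shift g P μ k]
    rfl

/-- Positive data keep the tilted marginals positive. -/
theorem tiltEvolve_pos [Nonempty X] {g : ℕ → X → ℝ} {P : ℕ → X → X → ℝ} {μ : X → ℝ}
    (hμ : ∀ x, 0 < μ x) (hg : ∀ k x, 0 < g k x) (hP : ∀ k x y, 0 < P k x y) :
    ∀ k x, 0 < tiltEvolve g P μ k x
  | 0, x => hμ x
  | k + 1, y => by
    rw [tiltEvolve_succ]
    unfold stepLaw
    exact sum_pos (fun x _ => mul_pos (mul_pos (hg k x) (tiltEvolve_pos hμ hg hP k x)) (hP k x y))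
      univ_nonempty

/-- Mass recursion: with unit row sums, `|ν_{k+1}| = ν_k[g_k] = Σ_x g_k(x) ν_k(x)`. -/
theorem sum_tiltEvolve_succ {g : ℕ → X → ℝ} {P : ℕ → X → X → ℝ} (hP : ∀ k x, ∑ y, P k x y = 1)
    (μ : X → ℝ) (k : ℕ) :
    ∑ y, tiltEvolve g P μ (k + 1) y = ∑ x, g k x * tiltEvolve g P μ k x := by
  rw [tiltEvolve_succ]
  unfold stepLaw
  rw [sum_comm]
  exact sum_congr rfl fun x _ => by rw [← mul_sum, hP k x, mul_one]

/-! ## Feynman–Kac marginalisation on path space -/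

omit [Fintype X] in
/-- Peeling the first factor off a product of one-time weights along a `Fin.cons` path. -/
theorem prod_weight_cons {n : ℕ} (g : ℕ → X → ℝ) (x₀ : X) (ω : Fin (n + 1) → X) :
    ∏ k : Fin (n + 1), g k ((Fin.cons x₀ ω : Fin (n + 2) → X) k.castSucc)
      = g 0 x₀ * ∏ k : Fin n, g (k + 1) (ω k.castSucc) := by
  rw [Fin.prod_univ_succ]
  rfl

/-- **FEYNMAN–KAC MARGINALISATION.**  `Σ_ω pathLaw μ P ω · Π_{k<n} g_k(ω_k) · f(ω_n)
= Σ_x (tiltEvolve g P μ n)(x) · f(x)` (peel the first step and induct with `tiltEvolve_succ_shift`,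
as in `Exactness.jarzynski_observable`). -/
theorem sum_pathLaw_prod_mul_apply : ∀ (n : ℕ) (μ : X → ℝ) (g : ℕ → X → ℝ)
    (P : ℕ → X → X → ℝ) (f : X → ℝ),
    ∑ ω : Fin (n + 1) → X, pathLaw μ (fun k : Fin n => P k) ω *
        (∏ k : Fin n, g k (ω k.castSucc)) * f (ω (Fin.last n))
      = ∑ x, tiltEvolve g P μ n x * f x
  | 0, μ, g, P, f => by
    rw [sum_path_zero]
    refine sum_congr rfl fun x _ => ?_
    simp [pathLaw, transProb, tiltEvolve]
  | n + 1, μ, g, P, f => by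
    have ih := sum_pathLaw_prod_mul_apply n (stepLaw (P 0) (fun x => g 0 x * μ x))
      (fun k => g (k + 1)) (fun k => P (k + 1)) f
    rw [← tiltEvolve_succ_shift] at ih
    rw [← ih, sum_path_cons]
    have hsummand : ∀ (x₀ : X) (ω : Fin (n + 1) → X),
        pathLaw μ (fun k : Fin (n + 1) => P k) (Fin.cons x₀ ω : Fin (n + 2) → X) *
            (∏ k : Fin (n + 1), g k ((Fin.cons x₀ ω : Fin (n + 2) → X) k.castSucc)) *
            f ((Fin.cons x₀ ω : Fin (n + 2) → X) (Fin.last (n + 1)))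
          = (g 0 x₀ * μ x₀ * P 0 x₀ (ω 0)) *
            (transProb (fun k : Fin n => P (k + 1)) ω *
              (∏ k : Fin n, g (k + 1) (ω k.castSucc)) * f (ω (Fin.last n))) := by
      intro x₀ ω
      have hP : transProb (fun k : Fin (n + 1) => P k) (Fin.cons x₀ ω : Fin (n + 2) → X)
          = P 0 x₀ (ω 0) * transProb (fun k : Fin n => P (k + 1)) ω := by
        rw [transProb_cons]
        simp only [Fin.val_zero, Fin.val_succ]
      rw [pathLaw, Fin.cons_zero, hP, prod_weight_cons, ← Fin.succ_last, Fin.cons_succ]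
      ring
    simp_rw [hsummand]
    rw [sum_comm]
    refine sum_congr rfl fun ω _ => ?_
    rw [← sum_mul]
    have hμ₁ : pathLaw (stepLaw (P 0) fun x => g 0 x * μ x) (fun k : Fin n => P (k + 1)) ω
        = (∑ x, g 0 x * μ x * P 0 x (ω 0)) * transProb (fun k : Fin n => P (k + 1)) ω := rfl
    rw [hμ₁]
    ring

omit [Fintype X] in
/-- `(e^{−W})² = Π_{k<n} e^{−2(S_{k+1}(ω_k) − S_k(ω_k))}`: the squared Jarzynski weight is a
product of one-time weights, so `E_F[e^{−2W}]` is a tilted mass (`sum_pathLaw_prod_mul_apply`). -/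
theorem exp_neg_work_sq_eq_prod {n : ℕ} (S : Fin (n + 1) → X → ℝ) (ω : Fin (n + 1) → X) :
    Real.exp (-(work S ω)) ^ 2
      = ∏ k : Fin n, Real.exp (-2 * (S k.succ (ω k.castSucc) - S k.castSucc (ω k.castSucc))) := by
  rw [← Real.exp_nat_mul, ← Real.exp_sum]
  congr 1
  unfold work
  push_cast
  rw [mul_neg, Finset.mul_sum, ← Finset.sum_neg_distrib]
  exact sum_congr rfl fun k _ => by ring

/-! ## The deviation of an un-normalised measure from its own-mass multiple of `π` -/

/-- `massDev π ν = ‖ν − |ν|·π‖_{L²(1/π)} = √(Σ_x (ν(x) − |ν|π(x))²/π(x))`, `|ν| = Σ ν` (for unit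
mass, `√χ²(ν ‖ π)`; `1`-homogeneous in `ν`, which is what makes the tilted recursion LINEAR). -/
noncomputable def massDev (π ν : X → ℝ) : ℝ :=
  Real.sqrt (∑ x, (ν x - (∑ y, ν y) * π x) ^ 2 / π x)

/-- `massDev` is non-negative. -/
theorem massDev_nonneg (π ν : X → ℝ) : 0 ≤ massDev π ν := Real.sqrt_nonneg _

/-- The sum under the square root of `massDev` is non-negative for a positive reference law. -/
theorem sum_sq_sub_mass_div_nonneg {π : X → ℝ} (hπ : ∀ x, 0 < π x) (ν : X → ℝ) :
    0 ≤ ∑ x, (ν x - (∑ y, ν y) * π x) ^ 2 / π x :=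
  sum_nonneg fun x _ => div_nonneg (sq_nonneg _) (hπ x).le

/-- `massDev²` is the sum it is the square root of. -/
theorem massDev_sq {π : X → ℝ} (hπ : ∀ x, 0 < π x) (ν : X → ℝ) :
    massDev π ν ^ 2 = ∑ x, (ν x - (∑ y, ν y) * π x) ^ 2 / π x :=
  Real.sq_sqrt (sum_sq_sub_mass_div_nonneg hπ ν)

/-- Homogeneity on unit-mass laws: `massDev π (c·μ) = |c|·√χ²(μ ‖ π)`. -/
theorem massDev_smul (π : X → ℝ) {μ : X → ℝ} (hμ1 : ∑ x, μ x = 1) (c : ℝ) :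
    massDev π (fun x => c * μ x) = |c| * Real.sqrt (chiSqDiv μ π) := by
  unfold massDev
  rw [← mul_sum, hμ1, mul_one, chiSqDiv_eq_sum_sq_div, ← Real.sqrt_sq_eq_abs,
    ← Real.sqrt_mul (sq_nonneg c), mul_sum]
  congr 1
  exact sum_congr rfl fun x _ => by ring

/-- For a unit-mass `ν`, `massDev π ν = √χ²(ν ‖ π)`. -/
theorem massDev_of_sum_eq_one (π : X → ℝ) {ν : X → ℝ} (hν1 : ∑ x, ν x = 1) :
    massDev π ν = Real.sqrt (chiSqDiv ν π) := by
  have h := massDev_smul π hν1 1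
  simp only [one_mul, abs_one] at h
  exact h

/-- Multiples of `π` have deviation zero (`Σ π = 1`). -/
theorem massDev_mul_self {π : X → ℝ} (hπ1 : ∑ x, π x = 1) (c : ℝ) :
    massDev π (fun x => c * π x) = 0 := by
  have h0 : chiSqDiv π π = 0 := by rw [chiSqDiv_eq_sum_sq_div]; simp
  rw [massDev_smul π hπ1 c, h0, Real.sqrt_zero, mul_zero]

/-- `stepLaw` is linear in the measure (scalar multiples). -/
theorem stepLaw_const_mul (K : X → X → ℝ) (c : ℝ) (μ : X → ℝ) :
    stepLaw K (fun x => c * μ x) = fun y => c * stepLaw K μ y := by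
  funext y
  unfold stepLaw
  rw [mul_sum]
  exact sum_congr rfl fun x _ => by ring

/-! ## The scalar comparison lemma -/

/-- **Coupled majorant system.**  If `u_0 ≤ 1`, `v_0 ≤ 0`, `u_{k+1} ≤ u_k + s·v_k` and
`v_{k+1} ≤ a·u_k + θ·v_k` with `s, a ≥ 0`, `0 ≤ θ < 1`, then with `κ = s·a/(1−θ)`:
`u_k ≤ (1+κ)^k` and `v_k ≤ (a/(1−θ))·(1+κ)^k` for every `k`. -/
theorem coupled_majorant_bound {u v : ℕ → ℝ} {s a θ : ℝ} (hs : 0 ≤ s) (ha : 0 ≤ a)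
    (hθ0 : 0 ≤ θ) (hθ1 : θ < 1) (hu0 : u 0 ≤ 1) (hv0 : v 0 ≤ 0)
    (hu : ∀ k, u (k + 1) ≤ u k + s * v k) (hv : ∀ k, v (k + 1) ≤ a * u k + θ * v k) :
    ∀ k, u k ≤ (1 + s * a / (1 - θ)) ^ k ∧ v k ≤ a / (1 - θ) * (1 + s * a / (1 - θ)) ^ k
  | 0 => by
    refine ⟨by simpa using hu0, ?_⟩
    rw [pow_zero, mul_one]
    exact hv0.trans (div_nonneg ha (by linarith))
  | k + 1 => by
    obtain ⟨ihu, ihv⟩ := coupled_majorant_bound hs ha hθ0 hθ1 hu0 hv0 hu hv k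
    have h1θ : 0 < 1 - θ := by linarith
    have hκ : 0 ≤ s * a / (1 - θ) := div_nonneg (mul_nonneg hs ha) h1θ.le
    set B := (1 + s * a / (1 - θ)) ^ k with hB
    have hB0 : 0 ≤ B := pow_nonneg (by linarith) k
    have hBsucc : (1 + s * a / (1 - θ)) ^ (k + 1) = B * (1 + s * a / (1 - θ)) := pow_succ _ _
    constructor
    · calc u (k + 1) ≤ u k + s * v k := hu k
        _ ≤ B + s * (a / (1 - θ) * B) := add_le_add ihu (mul_le_mul_of_nonneg_left ihv hs)
        _ = (1 + s * a / (1 - θ)) ^ (k + 1) := by rw [hBsucc]; field_simp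
    · calc v (k + 1) ≤ a * u k + θ * v k := hv k
        _ ≤ a * B + θ * (a / (1 - θ) * B) :=
            add_le_add (mul_le_mul_of_nonneg_left ihu ha) (mul_le_mul_of_nonneg_left ihv hθ0)
        _ = a / (1 - θ) * B := by field_simp; ring
        _ ≤ a / (1 - θ) * (1 + s * a / (1 - θ)) ^ (k + 1) := by
            rw [hBsucc]
            refine mul_le_mul_of_nonneg_left ?_ (div_nonneg ha h1θ.le)
            have : B * 1 ≤ B * (1 + s * a / (1 - θ)) :=
              mul_le_mul_of_nonneg_left (by linarith) hB0
            simpa using this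

/-- Exponential form: under the hypotheses of `coupled_majorant_bound`,
`u_k ≤ exp(k · s·a/(1−θ))`. -/
theorem coupled_majorant_exp_bound {u v : ℕ → ℝ} {s a θ : ℝ} (hs : 0 ≤ s) (ha : 0 ≤ a)
    (hθ0 : 0 ≤ θ) (hθ1 : θ < 1) (hu0 : u 0 ≤ 1) (hv0 : v 0 ≤ 0)
    (hu : ∀ k, u (k + 1) ≤ u k + s * v k) (hv : ∀ k, v (k + 1) ≤ a * u k + θ * v k) (k : ℕ) :
    u k ≤ Real.exp (k * (s * a / (1 - θ))) := by
  have h := (coupled_majorant_bound hs ha hθ0 hθ1 hu0 hv0 hu hv k).1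
  have hκ : 0 ≤ s * a / (1 - θ) := div_nonneg (mul_nonneg hs ha) (by linarith)
  refine h.trans ?_
  rw [Real.exp_nat_mul]
  exact pow_le_pow_left₀ (by linarith) (by linarith [Real.add_one_le_exp (s * a / (1 - θ))]) k

end Summit.Ventures.LatticeQCDFlow.Scaling

namespace Summit.Ventures.LatticeQCDFlow.Scaling
open Summit.Ventures.LatticeQCDFlow.Exactness in
/-- `e^{−tW} = Π_{k<n} e^{−t(S_{k+1}(ω_k) − S_k(ω_k))}` for every real `t` (the general tilt of
`exp_neg_work_sq_eq_prod`): `E_F[e^{−tW}]` is a tilted mass too (`Scaling/TiltedProtocolMoments`). -/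
theorem exp_neg_mul_work_eq_prod {X : Type*} {n : ℕ} (t : ℝ) (S : Fin (n + 1) → X → ℝ)
    (ω : Fin (n + 1) → X) :
    Real.exp (-(t * work S ω))
      = ∏ k : Fin n, Real.exp (-(t * (S k.succ (ω k.castSucc) - S k.castSucc (ω k.castSucc)))) := by
  rw [← Real.exp_sum]
  congr 1
  unfold work
  rw [Finset.mul_sum, ← Finset.sum_neg_distrib]
end Summit.Ventures.LatticeQCDFlow.Scaling
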